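import Summits.BirchSwinnertonDyer.Rank1Residual.X1.GeneratorCountLayerTransport
import HarnessLib

/-!
# The cocycle of a transported layer class: `kerH1Iso (h_0 (res (Ψ [φ]))) = [τ ↦ β⁻¹ φ(τ|_{K_n})]`
# (cell `b2b-bsdres`, unit `b2b-bsdres-eisenstein-p1`, gen 18; X1R0-GAPMAP §27.3, memo §4.5/§4.8 (R1′))

HONEST FRAMING (run/shared/lean/b2b/bsd-rank1-residual/, verbatim in every file): the goal of the
cell is to DELETE the COMBINATION-SHAPED residual classes of the Birch–Swinnerton-Dyer formula for
ALL analytic-rank `≤ 1` elliptic curves over `ℚ` — "full BSD formula for every rank `≤ 1` curve in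
class `C`" assembled STRICTLY from published theorems — so that the rank-`≤ 1` remainder becomes
exactly the CONSTRUCTION-SHAPED classes, which are TYPED (missing-input `Prop`s), NOT attempted.
This is not "finishing BSD". Sub-cell `b2b-bsdres-eisenstein-p1`: research route; NO CLAIM BEYOND
STATED CLASSES; nothing here changes a label; nothing is booked. THEOREMS ONLY — no definition, no
named fact; K-general (any number field `K`, any `ℤ_p`-extension `κ`, its layer `K_n` and restricted
tower `κ_n`).

What. The layer-`n` count (FILE 9 `X1/GeneratorCountLayerAtP`, FILE 6
`X1/GeneratorCountLayerTransport`) transports a class `y = [φ] ∈ H¹(K_n, E_{K_n}[p])` of the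
base-changed curve into `H¹(ker κ, E[p^∞])` by n1011's `kerH1Iso ∘ h_0 ∘ res ∘ Ψ`
(`Additive/ZpTowerKernelH1`). For the local term at the prime over `p` (route R1′ of the memo; the
ℚ-specific socket is `X1/StrictAtPOfInertia`) one needs this transported class ON COCYCLES:
**`exists_cocycle_kerH1Iso_layerToInfty`: it is the class of a cocycle `F` on `ker κ` with
`F(τ) = β⁻¹(ι φ(kerOfKer τ))`** (`β = primaryBaseChangeEquiv`, `ι : E[p] ↪ E[p^∞]`,
`kerOfKer : ker κ → ker κ_n`). Stated K-generally, in FILE 6's context, so that it instantiates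
against n1011's binder `hκn` by `rw` (an identical ℚ-specific statement elaborates the binder
through ℚ-specific instance paths and does not rewrite within the default heartbeat budget —
X1R0-GAPMAP §27.3).

References: [SerreGaloisCohomology1997] I.§2.4; [GreenbergLNM1716] §3; X1R0-GAPMAP §27.3.
-/

noncomputable section

open scoped Classical

open Function Field NumberField IsDedekindDomain WeierstrassCurve PowerSeries
  Literature.NumberTheory.EllipticCurves Literature.NumberTheory.GaloisRepresentations
  Literature.NumberTheory.GaloisCohomology
  Literature.NumberTheory.EllipticCurves.IwasawaAlgebra IsLocalRing
  Summit.BirchSwinnertonDyer.Rank1Residual.Additive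
  Summit.BirchSwinnertonDyer.Rank1Residual.Additive.ZpTower

set_option autoImplicit false

namespace Summit.BirchSwinnertonDyer.Rank1Residual.X1.KerH1IsoCocycle

variable {K : Type} [Field K] [NumberField K] {p : ℕ} [hp : Fact p.Prime]
variable (W : WeierstrassCurve K) (κ : ZpExtension K p) (n : ℕ) (κn : ZpExtension (κ.layer n) p)
  (hκn : ∀ σ : Field.absoluteGaloisGroup (κ.layer n),
    (κn σ).toAdd * (p : ℤ_[p]) ^ n = (κ (resGal (K := K) (κ.layer n) σ)).toAdd)

omit [NumberField K] in
/-- `h_0 ∘ res_{K_0} = res_{K_∞}` on `H¹(K_n, E_{K_n}[p^∞])` (the layer-`0` step of the restricted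
tower is restriction to `ker κ_n`). [cite: SerreGaloisCohomology1997, I.§2.4] -/
theorem layerToInfty_zero_resH1Hom (c : (W.baseChange (κ.layer n)).galH1Primary p) :
    (W.baseChange (κ.layer n)).layerToInfty κn 0
        (resH1Hom (Literature.NumberTheory.EllipticCurves.subgroupIncl (κn.layerSubgroup 0))
          (AddMonoidHom.id (geomPrimaryTorsion (W.baseChange (κ.layer n)) p)) (fun _ _ ↦ rfl) c) =
      resH1Hom (Literature.NumberTheory.EllipticCurves.subgroupIncl κn.kerSubgroup)
        (AddMonoidHom.id (geomPrimaryTorsion (W.baseChange (κ.layer n)) p)) (fun _ _ ↦ rfl) c := by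
  change resH1Hom (subgroupInclusion (κn.kerSubgroup_le_layerSubgroup 0))
    (AddMonoidHom.id (geomPrimaryTorsion (W.baseChange (κ.layer n)) p)) (fun _ _ ↦ rfl)
    (resH1Hom _ _ _ c) = _
  rw [resH1Hom_resH1Hom]
  exact DFunLike.congr_fun (resH1Hom_congr (by ext; rfl) (by ext; rfl) _ _) c

set_option maxHeartbeats 400000 in
include hκn in
/-- **The cocycle of the transported class.** For a cocycle `φ` of `Gal(K̄_n/K_n)` with values in
`E_{K_n}[p]`, the class `kerH1Iso (h_0 (res (Ψ [φ])))` in `H¹(ker κ, E[p^∞])` is the class of a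
cocycle `F` with `F(τ) = β⁻¹(ι φ(kerOfKer τ))` (`β = primaryBaseChangeEquiv`, `ι : E[p] ↪ E[p^∞]`).
[cite: SerreGaloisCohomology1997, I.§2.4] -/
theorem exists_cocycle_kerH1Iso_layerToInfty
    (φ : contOneCocycles (discreteTopRep (Field.absoluteGaloisGroup (κ.layer n))
      (geomTorsion (W.baseChange (κ.layer n)) (p : ℤ)))) :
    ∃ F : contOneCocycles (discreteTopRep κ.kerSubgroup (W.geomPrimaryTorsion p)),
      kerH1Iso W κ n κn hκn ((W.baseChange (κ.layer n)).layerToInfty κn 0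
        (resH1Hom (Literature.NumberTheory.EllipticCurves.subgroupIncl (κn.layerSubgroup 0))
          (AddMonoidHom.id (geomPrimaryTorsion (W.baseChange (κ.layer n)) p)) (fun _ _ ↦ rfl)
          (torsionToPrimaryH1 (W.baseChange (κ.layer n)) p (oneCocycleClass _ φ)))) =
        oneCocycleClass (discreteTopRep κ.kerSubgroup (W.geomPrimaryTorsion p)) F ∧
      ∀ τ : κ.kerSubgroup, F.1 τ = (primaryBaseChangeEquiv (κ.layer n) W p).symm
        (AddSubgroup.inclusion (geomTorsion_le_geomPrimaryTorsion (W.baseChange (κ.layer n)) p)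
          (φ.1 ((kerOfKer κ n κn hκn τ : κn.kerSubgroup) : Field.absoluteGaloisGroup (κ.layer n)))) := by
  rw [layerToInfty_zero_resH1Hom, kerH1Iso_apply, torsionToPrimaryH1_oneCocycleClass,
    resH1Hom_resH1Hom, resH1Hom_oneCocycleClass]
  refine ⟨_, rfl, fun τ ↦ ?_⟩
  rw [pullback_resHomOfEquivariant_apply]
  simp only [AddMonoidHom.coe_comp, Function.comp_apply, AddMonoidHom.id_apply,
    AddEquiv.coe_toAddMonoidHom, ContinuousMonoidHom.comp_toFun]
  rfl

end Summit.BirchSwinnertonDyer.Rank1Residual.X1.KerH1IsoCocycle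

end
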